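import Summits.AtomisticToContinuum.HydrodynamicLimit.Theorems.CollisionIsometryCLTCollisionalTransferLocalityDefsB
import Summits.AtomisticToContinuum.HydrodynamicLimit.Theorems.CollisionIsometryCLTCollisionalTransferLocalityBalanceIdentity
import Summits.AtomisticToContinuum.HydrodynamicLimit.Theorems.CollisionIsometryCLTCollisionalTransferLocalityRhsSupConst
import HarnessLib

/-!
# Channel additivity of the conclusion of the crux `CollisionalTransferLocality`
(registered stub `stub_channelAdditivity`, [G2] of skeleton v16, line `hemisphere-affine-slaving`,
crux stmt-AtomisticToContinuum-9518)

The crux compares the collisional residual `Cc(τ)` of the `(ψ, χ)`-tested momentum + energy balance with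
`Rhs(τ) = ∫₀^τ∫ₓ (div ψ + ∇χ·ū) p_c(ρ̄, θ̄)`, uniformly in `τ ≤ t`, in local-Gibbs probability. Everything
is LINEAR in the pair of tests `(ψ, χ)`; this file proves the bookkeeping statement that the conclusion at
`(ψ, 0)` and at `(0, χ)` gives it at `(ψ, χ)`:
* on the good set `Cc = J_N` for `τ ∈ [0, t]` ([S1] `stub_balanceIdentity`) and the jump sum `J_N` is
  additive in `(ψ, χ)` (`jumpK ψ χ = jumpK ψ 0 + jumpK 0 χ` pointwise; finitely many collision times in
  `(0, τ]` on a good orbit, `collisionPairSum_add`);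
* `Rhs` is additive on the event "no block denser than `η₁/σ³` before `t`" intersected with the good
  set: `eulerW ψ χ = eulerW ψ 0 + eulerW 0 χ` pointwise (`div 0 = 0`, `∇0 = 0`), and the slice
  integrands `x ↦ eulerW · p_c(ρ̄, θ̄)` are integrable on `𝕋³` (jointly measurable through the clamped
  weights, `measurable_eulerIntegrand`; bounded by the pointwise envelope `abs_eulerW_mul_pcoll_le`
  with `|div ψ|, |∂χ| ≤ C₁`), their `x`-integrals measurable in `s` along the orbit and bounded on
  `[0, t]` (energy conservation bounds the speeds, the kernel is bounded), so `∫ (f + g) = ∫ f + ∫ g`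
  in `x` and then in `s ∈ [0, τ]`;
* off these two events the probability is `0` (`localGibbsLaw_compl_good'`) resp. `→ 0` (`DiluteAt`);
  triangle inequality and a union bound at level `δ/2` (`measure_le_of_imp3`).
Folklore bookkeeping; no source is cited.
-/

namespace Summit.AtomisticToContinuum.HydrodynamicLimit.Theorems.HemisphereAffineSlaving

open scoped BigOperators Topology Classical ENNReal InnerProductSpace
open Filter Set Function MeasureTheory
open Literature.Analysis.FunctionSpaces Literature.Analysis.FluidPDE

noncomputable section

open Literature.MathematicalPhysics.KineticTheory (T3 V3 localGibbsLaw hsCompressibility)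

namespace ChannelAdditivity

/-! ### The zero tests -/

/-- The gradient weight of the zero scalar test vanishes (`∇0 = 0`). [folklore] -/
theorem gradChi_zero (s : ℝ) (x : T3) : gradChi (fun (_ : ℝ) (_ : T3) => (0 : ℝ)) s x = 0 := by
  -- adapted from Literature/Analysis/FluidPDE/EulerReynolds.lean (`Torus.gradient_zero`)
  unfold gradChi Literature.Analysis.FunctionSpaces.Torus.gradient
    Literature.Analysis.FunctionSpaces.Torus.liftAt
  simp [_root_.gradient]

/-- The divergence weight of the zero vector test vanishes (`div 0 = 0`). [folklore] -/
theorem divPsi_zero (s : ℝ) (x : T3) : divPsi (fun (_ : ℝ) (_ : T3) => (0 : V3)) s x = 0 := by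
  -- adapted from Literature/Analysis/FluidPDE/EulerReynolds.lean (`Torus.divergence_zero`)
  unfold divPsi Literature.Analysis.FunctionSpaces.Torus.divergence
    Literature.Analysis.FunctionSpaces.Torus.partialDeriv Literature.Analysis.FunctionSpaces.Torus.lineDeriv
  simp

/-- The Euler weight is additive in the pair of tests: `eulerW ψ χ = eulerW ψ 0 + eulerW 0 χ`. [folklore] -/
theorem eulerW_add (ψ : ℝ → T3 → V3) (χ : ℝ → T3 → ℝ) (φ : ℕ → T3 → ℝ) (N : ℕ) (s : ℝ)
    (w : Cfg N) (x : T3) :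
    eulerW ψ χ φ N s w x = eulerW ψ (fun (_ : ℝ) (_ : T3) => (0 : ℝ)) φ N s w x +
      eulerW (fun (_ : ℝ) (_ : T3) => (0 : V3)) χ φ N s w x := by
  simp [eulerW, gradChi_zero, divPsi_zero]

/-- The jump kernel is additive in the pair of tests: `jumpK ψ χ = jumpK ψ 0 + jumpK 0 χ`. [folklore] -/
theorem jumpK_add (ψ : ℝ → T3 → V3) (χ : ℝ → T3 → ℝ) (N : ℕ) (s : ℝ) (w : Cfg N)
    (i j : Fin (N + 1)) :
    jumpK ψ χ N s w i j = jumpK ψ (fun (_ : ℝ) (_ : T3) => (0 : ℝ)) N s w i j +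
      jumpK (fun (_ : ℝ) (_ : T3) => (0 : V3)) χ N s w i j := by
  simp [jumpK]

/-- The jump sum over a GOOD orbit is additive in the pair of tests (finitely many collision times
in `(0, τ]`). [folklore] -/
theorem Jfun_add {σ : ℝ} (Φ : Flows σ) (ψ : ℝ → T3 → V3) (χ : ℝ → T3 → ℝ) {N : ℕ} {z : Cfg N}
    (hz : z ∈ (Φ N).good) (τ : ℝ) :
    Jfun σ Φ ψ χ N z τ = Jfun σ Φ ψ (fun (_ : ℝ) (_ : T3) => (0 : ℝ)) N z τ +
      Jfun σ Φ (fun (_ : ℝ) (_ : T3) => (0 : V3)) χ N z τ := by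
  have hfin := (Φ N).finite_collisionTimes_inter hz (Ioc_subset_Icc_self : Ioc (0 : ℝ) τ ⊆ Icc 0 τ)
  have hsum : (fun s i j => jumpK ψ χ N s ((Φ N).flow s z) i j) = fun s i j =>
      jumpK ψ (fun (_ : ℝ) (_ : T3) => (0 : ℝ)) N s ((Φ N).flow s z) i j +
        jumpK (fun (_ : ℝ) (_ : T3) => (0 : V3)) χ N s ((Φ N).flow s z) i j :=
    funext fun s => funext fun i => funext fun j => jumpK_add ψ χ N s _ i j
  simp only [Jfun, HardSphereFlow.collisionPairSum]
  rw [hsum, Literature.Analysis.FluidPDE.collisionPairSum_add hfin, mul_add]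

/-! ### Integrability of the slices of `Rhs` along a good, dilute orbit -/

/-- On a configuration with speeds `≤ R` and a kernel `0 ≤ φ ≤ Φb` the pointwise envelope
`4Ē + (N+1)⁻¹ Σᵢ φ(xᵢ − x)‖vᵢ‖⁴` is at most `2 Φb R² + Φb R⁴`. [folklore] -/
theorem envelope_le_const {φ : ℕ → T3 → ℝ} {N : ℕ} {w : Cfg N} {Φb R : ℝ} (hφ0 : ∀ y, 0 ≤ φ N y)
    (hφb : ∀ y, φ N y ≤ Φb) (hv : ∀ i, ‖(w i).2‖ ≤ R) (x : T3) :
    4 * EB φ N w x + ((N + 1 : ℕ) : ℝ)⁻¹ * ∑ i, φ N ((w i).1 - x) * ‖(w i).2‖ ^ 4 ≤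
      4 * (Φb * (R ^ 2 / 2)) + Φb * R ^ 4 := by
  have hΦb0 : 0 ≤ Φb := (hφ0 0).trans (hφb 0)
  have hN : ((N + 1 : ℕ) : ℝ) ≠ 0 := by positivity
  have havg : ∀ c : ℝ, ((N + 1 : ℕ) : ℝ)⁻¹ * ∑ _i : Fin (N + 1), c = c := fun c => by
    rw [Finset.sum_const, Finset.card_univ, Fintype.card_fin, nsmul_eq_mul, ← mul_assoc,
      inv_mul_cancel₀ hN, one_mul]
  have h1 : EB φ N w x ≤ Φb * (R ^ 2 / 2) := by
    rw [EB_eq]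
    calc ((N + 1 : ℕ) : ℝ)⁻¹ * ∑ i, φ N ((w i).1 - x) * (‖(w i).2‖ ^ 2 / 2)
        ≤ ((N + 1 : ℕ) : ℝ)⁻¹ * ∑ _i : Fin (N + 1), Φb * (R ^ 2 / 2) :=
          mul_le_mul_of_nonneg_left (Finset.sum_le_sum fun i _ =>
            mul_le_mul (hφb _) (div_le_div_of_nonneg_right
              (pow_le_pow_left₀ (norm_nonneg _) (hv i) 2) zero_le_two)
              (by positivity) hΦb0) (by positivity)
      _ = Φb * (R ^ 2 / 2) := havg _
  have h2 : ((N + 1 : ℕ) : ℝ)⁻¹ * ∑ i, φ N ((w i).1 - x) * ‖(w i).2‖ ^ 4 ≤ Φb * R ^ 4 := by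
    calc ((N + 1 : ℕ) : ℝ)⁻¹ * ∑ i, φ N ((w i).1 - x) * ‖(w i).2‖ ^ 4
        ≤ ((N + 1 : ℕ) : ℝ)⁻¹ * ∑ _i : Fin (N + 1), Φb * R ^ 4 :=
          mul_le_mul_of_nonneg_left (Finset.sum_le_sum fun i _ =>
            mul_le_mul (hφb _) (pow_le_pow_left₀ (norm_nonneg _) (hv i) 4)
              (by positivity) hΦb0) (by positivity)
      _ = Φb * R ^ 4 := havg _
  linarith

/-- **Integrability of the slices of `Rhs` along a good, dilute orbit.** For `σ > 0`, `K ≥ 0`,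
`0 < η₁ ≤ η_Z` with `|Z(η) − 1| ≤ Kη` on `[0, η_Z]`, a continuous nonnegative kernel, tests smooth
on `[0, t]`, a good initial datum whose orbit has no block denser than `η₁/σ³` on `[0, t]`:
(i) for `s ∈ [0, t]` the slice `x ↦ eulerW · p_c(ρ̄, θ̄)` at `Φ_s z` is integrable on `𝕋³`;
(ii) for `τ ∈ [0, t]` its `x`-integral is integrable in `s` on `[0, τ]`. [folklore] -/
theorem integrable_eulerSlice {σ K ηZ η₁ : ℝ} (hσ : 0 < σ) (hK : 0 ≤ K) (hη₁ : 0 < η₁)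
    (hη₁Z : η₁ ≤ ηZ) (hZ : ∀ η : ℝ, 0 ≤ η → η ≤ ηZ → |hsCompressibility η - 1| ≤ K * η)
    (Φ : Flows σ) {φ : ℕ → T3 → ℝ} {N : ℕ} (hφc : Continuous (φ N)) (hφ0 : ∀ y, 0 ≤ φ N y)
    {t : ℝ} (ht : 0 < t) {ψ : ℝ → T3 → V3} {χ : ℝ → T3 → ℝ}
    (hψ : Literature.Analysis.FunctionSpaces.Torus.IsSmoothSpaceTimeOn (Icc 0 t) ψ)
    (hχ : Literature.Analysis.FunctionSpaces.Torus.IsSmoothSpaceTimeOn (Icc 0 t) χ)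
    {z : Cfg N} (hz : z ∈ (Φ N).good)
    (hdil : ∀ s ∈ Icc 0 t, ∀ x, rhoB φ N ((Φ N).flow s z) x * σ ^ 3 ≤ η₁) :
    (∀ s ∈ Icc 0 t, Integrable fun x => eulerW ψ χ φ N s ((Φ N).flow s z) x *
        pcoll σ (rhoB φ N ((Φ N).flow s z) x) (thetaB φ N ((Φ N).flow s z) x)) ∧
    ∀ τ ∈ Icc 0 t, IntegrableOn (fun s => ∫ x, eulerW ψ χ φ N s ((Φ N).flow s z) x *
        pcoll σ (rhoB φ N ((Φ N).flow s z) x) (thetaB φ N ((Φ N).flow s z) x)) (Icc 0 τ) := by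
  -- the test fields: a common gradient bound, clamped-in-time weight fields
  -- (adapted from the proof of `rhs_sup_tendsto_zero_const`, file …RhsSupConst)
  have hU : UniqueDiffOn ℝ (Icc 0 t) := uniqueDiffOn_Icc ht
  have hpI : ∀ {s}, s ∈ Icc 0 t → (projIcc 0 t ht.le s : ℝ) = s := fun hs => by
    rw [projIcc_of_mem ht.le hs]
  obtain ⟨C₃, hC₃0, hC₃ψ, hC₃χ⟩ := exists_grad_bound ht hψ hχ
  have hgψs : ∀ a : Fin 3, Torus.IsSmoothSpaceTimeOn (Icc 0 t)
      (fun s => Torus.gradient (fun y => ψ s y a)) := fun a => (hψ.apply a).gradient hU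
  have hgχs := hχ.gradient hU
  have hdiv_eq : ∀ {s}, s ∈ Icc 0 t → ∀ y, divPsi ψ s y = ∑ a, gradPsi ψ s y a a :=
    fun hs y => (sum_gradPsi_diag_eq_divergence (hψ.isSmooth_slice hs) y).symm
  have hdiv_b : ∀ {s}, s ∈ Icc 0 t → ∀ y, |divPsi ψ s y| ≤ 3 * C₃ := fun {s} hs y => by
    rw [hdiv_eq hs]
    calc |∑ a, gradPsi ψ s y a a| ≤ ∑ a, |gradPsi ψ s y a a| := Finset.abs_sum_le_sum_abs _ _
      _ ≤ ∑ _a : Fin 3, C₃ := Finset.sum_le_sum fun a _ => hC₃ψ s hs y a a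
      _ = 3 * C₃ := by simp
  have hgχ_b : ∀ {s}, s ∈ Icc 0 t → ∀ y a, |gradChi χ s y a| ≤ 3 * C₃ := fun hs y a =>
    (hC₃χ _ hs y a).trans (by linarith)
  obtain ⟨g₁, hg₁⟩ : ∃ g₁ : ℝ × T3 → ℝ, ∀ r, g₁ r = ∑ a, gradPsi ψ (projIcc 0 t ht.le r.1) r.2 a a :=
    ⟨_, fun _ => rfl⟩
  obtain ⟨g₂, hg₂⟩ : ∃ g₂ : ℝ × T3 → V3, ∀ r, g₂ r = gradChi χ (projIcc 0 t ht.le r.1) r.2 :=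
    ⟨_, fun _ => rfl⟩
  have hg₁c : Continuous g₁ := by
    rw [show g₁ = _ from funext hg₁]
    refine continuous_finsetSum _ fun a _ => ?_
    have hc := continuous_comp_projIcc ht (hgψs a)
    simp only [gradPsi]
    fun_prop
  have hg₂c : Continuous g₂ := by
    rw [show g₂ = _ from funext hg₂]
    simpa only [gradChi] using continuous_comp_projIcc ht hgχs
  -- the clamped integrand IS the integrand at times `s ∈ [0, t]`
  have hinteg_eq : ∀ {s}, s ∈ Icc 0 t → ∀ (w : Cfg N) (x : T3),
      (g₁ (s, x) + ∑ j, g₂ (s, x) j * uB φ N w x j) * pcoll σ (rhoB φ N w x) (thetaB φ N w x) =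
        eulerW ψ χ φ N s w x * pcoll σ (rhoB φ N w x) (thetaB φ N w x) := fun hs w x => by
    simp only [hg₁, hg₂, eulerW, hpI hs, hdiv_eq hs]
  obtain ⟨Y, hY⟩ : ∃ Y : ℝ → Cfg N → ℝ, ∀ s w, Y s w = ∫ x,
      (g₁ (s, x) + ∑ j, g₂ (s, x) j * uB φ N w x j) *
        pcoll σ (rhoB φ N w x) (thetaB φ N w x) := ⟨_, fun _ _ => rfl⟩
  have hYm : Measurable (uncurry Y) := by
    simpa only [hY, Function.uncurry_def] using measurable_integral_eulerIntegrand σ hφc hg₁c hg₂c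
  -- pointwise envelope on the dilute slices of the orbit
  have hpt : ∀ s ∈ Icc 0 t, ∀ x, |eulerW ψ χ φ N s ((Φ N).flow s z) x *
      pcoll σ (rhoB φ N ((Φ N).flow s z) x) (thetaB φ N ((Φ N).flow s z) x)| ≤
      3 * C₃ * K * η₁ * (4 * EB φ N ((Φ N).flow s z) x + ((N + 1 : ℕ) : ℝ)⁻¹ *
        ∑ i, φ N (((Φ N).flow s z i).1 - x) * ‖((Φ N).flow s z i).2‖ ^ 4) := fun s hs x =>
    RhsEnvelope.abs_eulerW_mul_pcoll_le hσ hK hη₁.le hη₁Z (by positivity) hZ hφ0 (hdiv_b hs x)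
      (hgχ_b hs x) (hdil s hs x)
  -- (i) integrability in `x`
  have hL1 : ∀ s ∈ Icc 0 t, Integrable fun x => eulerW ψ χ φ N s ((Φ N).flow s z) x *
      pcoll σ (rhoB φ N ((Φ N).flow s z) x) (thetaB φ N ((Φ N).flow s z) x) := by
    intro s hs
    have hEint : Integrable (fun x => EB φ N ((Φ N).flow s z) x) :=
      ((continuous_EB hφc).comp (continuous_const.prodMk continuous_id)).integrable_unitAddTorus
    have hFc : Continuous fun x : T3 => ((N + 1 : ℕ) : ℝ)⁻¹ *
        ∑ i, φ N (((Φ N).flow s z i).1 - x) * ‖((Φ N).flow s z i).2‖ ^ 4 := by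
      fun_prop
    have hgi : Integrable (fun x => 3 * C₃ * K * η₁ * (4 * EB φ N ((Φ N).flow s z) x +
        ((N + 1 : ℕ) : ℝ)⁻¹ * ∑ i, φ N (((Φ N).flow s z i).1 - x) * ‖((Φ N).flow s z i).2‖ ^ 4)) :=
      ((hEint.const_mul 4).add hFc.integrable_unitAddTorus).const_mul _
    have hmeas : AEStronglyMeasurable (fun x => eulerW ψ χ φ N s ((Φ N).flow s z) x *
        pcoll σ (rhoB φ N ((Φ N).flow s z) x) (thetaB φ N ((Φ N).flow s z) x)) volume := by
      have h := (measurable_eulerIntegrand σ hφc hg₁c hg₂c).comp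
        (measurable_const.prodMk measurable_id :
          Measurable fun x : T3 => ((s, (Φ N).flow s z), x))
      exact h.aestronglyMeasurable.congr (ae_of_all _ fun x => hinteg_eq hs _ x)
    exact hgi.mono' hmeas (ae_of_all _ fun x => by
      rw [Real.norm_eq_abs]
      exact hpt s hs x)
  refine ⟨hL1, fun τ hτ => ?_⟩
  -- (ii) integrability in `s`: a bound along the orbit and measurability through `Y`
  obtain ⟨Φb, hΦb⟩ := isCompact_univ.exists_bound_of_continuousOn hφc.continuousOn
  have hφb : ∀ y, φ N y ≤ Φb := fun y => by
    have h := hΦb y (mem_univ y)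
    rw [Real.norm_eq_abs] at h
    exact (le_abs_self _).trans h
  have hv : ∀ s i, ‖((Φ N).flow s z i).2‖ ≤ Real.sqrt (2 * configEnergy z) := fun s i =>
    norm_vel_orbit_le Φ hz s i
  set M : ℝ := 3 * C₃ * K * η₁ * (4 * (Φb * (Real.sqrt (2 * configEnergy z) ^ 2 / 2)) +
    Φb * Real.sqrt (2 * configEnergy z) ^ 4) with hM
  have hGb : ∀ s ∈ Icc 0 t, ‖∫ x, eulerW ψ χ φ N s ((Φ N).flow s z) x *
      pcoll σ (rhoB φ N ((Φ N).flow s z) x) (thetaB φ N ((Φ N).flow s z) x)‖ ≤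
      M * (volume : Measure T3).real univ := fun s hs => by
    refine norm_integral_le_of_norm_le_const (ae_of_all _ fun x => ?_)
    rw [Real.norm_eq_abs]
    refine (hpt s hs x).trans ?_
    rw [hM]
    exact mul_le_mul_of_nonneg_left (envelope_le_const hφ0 hφb (hv s) x) (by positivity)
  have hGm : AEStronglyMeasurable (fun s => ∫ x, eulerW ψ χ φ N s ((Φ N).flow s z) x *
      pcoll σ (rhoB φ N ((Φ N).flow s z) x) (thetaB φ N ((Φ N).flow s z) x))
      (volume.restrict (Icc 0 τ)) := by
    have h : Measurable fun s => Y s ((Φ N).flow s z) :=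
      hYm.comp (measurable_id.prodMk (measurable_orbit Φ hz))
    refine h.aestronglyMeasurable.congr ?_
    refine (ae_restrict_mem measurableSet_Icc).mono fun s hs => ?_
    have hs' : s ∈ Icc 0 t := ⟨hs.1, hs.2.trans hτ.2⟩
    show Y s ((Φ N).flow s z) = _
    rw [hY]
    exact integral_congr_ae (ae_of_all _ fun x => hinteg_eq hs' _ x)
  exact IntegrableOn.of_bound measure_Icc_lt_top hGm (M * (volume : Measure T3).real univ)
    ((ae_restrict_mem measurableSet_Icc).mono fun s hs => hGb s ⟨hs.1, hs.2.trans hτ.2⟩)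

/-- **`Rhs` is additive in the pair of tests along a good, dilute orbit** (for `τ ∈ [0, t]`):
`Rhs(ψ, χ) = Rhs(ψ, 0) + Rhs(0, χ)` — `eulerW` is additive pointwise and all slices are
integrable (`integrable_eulerSlice`). [folklore] -/
theorem Rhs_add {σ K ηZ η₁ : ℝ} (hσ : 0 < σ) (hK : 0 ≤ K) (hη₁ : 0 < η₁)
    (hη₁Z : η₁ ≤ ηZ) (hZ : ∀ η : ℝ, 0 ≤ η → η ≤ ηZ → |hsCompressibility η - 1| ≤ K * η)
    (Φ : Flows σ) {φ : ℕ → T3 → ℝ} {N : ℕ} (hφc : Continuous (φ N)) (hφ0 : ∀ y, 0 ≤ φ N y)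
    {t : ℝ} (ht : 0 < t) {ψ : ℝ → T3 → V3} {χ : ℝ → T3 → ℝ}
    (hψ : Literature.Analysis.FunctionSpaces.Torus.IsSmoothSpaceTimeOn (Icc 0 t) ψ)
    (hχ : Literature.Analysis.FunctionSpaces.Torus.IsSmoothSpaceTimeOn (Icc 0 t) χ)
    {z : Cfg N} (hz : z ∈ (Φ N).good)
    (hdil : ∀ s ∈ Icc 0 t, ∀ x, rhoB φ N ((Φ N).flow s z) x * σ ^ 3 ≤ η₁)
    {τ : ℝ} (hτ : τ ∈ Icc 0 t) :
    Rhs σ Φ φ ψ χ N z τ = Rhs σ Φ φ ψ (fun (_ : ℝ) (_ : T3) => (0 : ℝ)) N z τ +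
      Rhs σ Φ φ (fun (_ : ℝ) (_ : T3) => (0 : V3)) χ N z τ := by
  have h0χ : Torus.IsSmoothSpaceTimeOn (Icc 0 t) (fun (_ : ℝ) (_ : T3) => (0 : ℝ)) :=
    Torus.isSmoothSpaceTimeOn_const (Torus.isSmooth_const (0 : ℝ)) _
  have h0ψ : Torus.IsSmoothSpaceTimeOn (Icc 0 t) (fun (_ : ℝ) (_ : T3) => (0 : V3)) :=
    Torus.isSmoothSpaceTimeOn_const (Torus.isSmooth_const (0 : V3)) _
  obtain ⟨h1ψ, h2ψ⟩ := integrable_eulerSlice hσ hK hη₁ hη₁Z hZ Φ hφc hφ0 ht hψ h0χ hz hdil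
  obtain ⟨h1χ, h2χ⟩ := integrable_eulerSlice hσ hK hη₁ hη₁Z hZ Φ hφc hφ0 ht h0ψ hχ hz hdil
  unfold Rhs
  rw [← integral_add (h2ψ τ hτ) (h2χ τ hτ)]
  refine setIntegral_congr_fun measurableSet_Icc fun s hs => ?_
  have hs' : s ∈ Icc 0 t := ⟨hs.1, hs.2.trans hτ.2⟩
  beta_reduce
  rw [← integral_add (h1ψ s hs') (h1χ s hs')]
  refine integral_congr_ae (ae_of_all _ fun x => ?_)
  beta_reduce
  rw [eulerW_add, add_mul]

end ChannelAdditivity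

open ChannelAdditivity in
/-- **Registered stub [G2] `stub_channelAdditivity` (channel additivity of the conclusion of the
crux `CollisionalTransferLocality`, stmt-AtomisticToContinuum-9518, line hemisphere-affine-slaving,
skeleton v16).** At fixed `0 < σ ≤ 1/2`, a linear bound `|Z(η) − 1| ≤ Kη` on `[0, η_Z]`, a dilute
level `0 < η₁ ≤ η_Z`, profiles, a flow family, a family of continuous nonnegative kernels, a horizon
`t > 0` with the dilute event `DiluteAt … η₁`, and tests `ψ`, `χ` smooth on `[0, t]`: the crux's
conclusion at `(ψ, 0)` and at `(0, χ)` imply it at `(ψ, χ)`. On the good set `Cc = J_N`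
(`stub_balanceIdentity`) with `J_N` additive in `(ψ, χ)` (`Jfun_add`); on the all-times-dilute event
`Rhs` is additive (`Rhs_add`); the complement of the good set is null and the non-dilute event has
probability `→ 0`; union bound at level `δ/2` (`measure_le_of_imp3`). [folklore] -/
theorem stub_channelAdditivity : ∀ (σ : ℝ), 0 < σ → σ ≤ 1 / 2 → ∀ (ηZ K : ℝ), 0 < ηZ → 0 ≤ K → (∀ η : ℝ, 0 ≤ η → η ≤ ηZ → |Literature.MathematicalPhysics.KineticTheory.hsCompressibility η - 1| ≤ K * η) → ∀ η₁ : ℝ, 0 < η₁ → η₁ ≤ ηZ → ∀ (a₀ θ₀ : T3 → ℝ) (u₀ : T3 → V3) (Φ : Flows σ) (φ : ℕ → T3 → ℝ) (t : ℝ), 0 < t → (∀ N, Continuous (φ N)) → (∀ N y, 0 ≤ φ N y) → DiluteAt σ a₀ θ₀ u₀ Φ t φ η₁ → ∀ (ψ : ℝ → T3 → V3) (χ : ℝ → T3 → ℝ), Literature.Analysis.FunctionSpaces.Torus.IsSmoothSpaceTimeOn (Icc 0 t) ψ → Literature.Analysis.FunctionSpaces.Torus.IsSmoothSpaceTimeOn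 (Icc 0 t) χ → (∀ δ : ℝ, 0 < δ → Tendsto (fun N : ℕ => Literature.MathematicalPhysics.KineticTheory.localGibbsLaw σ a₀ u₀ θ₀ N (Φ N) {z | ∃ τ ∈ Icc 0 t, δ < |Cc σ Φ ψ (fun (_ : ℝ) (_ : T3) => (0 : ℝ)) N z τ - Rhs σ Φ φ ψ (fun (_ : ℝ) (_ : T3) => (0 : ℝ)) N z τ|}) atTop (𝓝 0)) → (∀ δ : ℝ, 0 < δ → Tendsto (fun N : ℕ => Literature.MathematicalPhysics.KineticTheory.localGibbsLaw σ a₀ u₀ θ₀ N (Φ N) {z | ∃ τ ∈ Icc 0 t, δ < |Cc σ Φ (fun (_ : ℝ) (_ : T3) => (0 : V3)) χ N z τ - Rhs σ Φ φ (fun (_ : ℝ) (_ : T3) => (0 : V3)) χ N z τ|}) atTop (𝓝 0)) → ∀ δ : ℝ, 0 < δ → Tendsto (fun N : ℕ => Literature.MathematicalPhysics.KineticTheory.localGibbsLaw σ a₀ u₀ θ₀ N (Φ N) {z | ∃ τ ∈ Icc 0 t, δ < |Cc σ Φ ψ χ N z τ - Rhs σ Φ φ ψ χ N z τ|}) atTop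 (𝓝 0) := by
  intro σ hσ hhalf ηZ K _hηZ hK hZK η₁ hη₁ hη₁Z a₀ θ₀ u₀ Φ φ t ht hφc hφ0 hDil ψ χ hψ hχ hA hB δ hδ
  have hBal := stub_balanceIdentity σ hσ hhalf Φ
  have h0χ : Torus.IsSmoothSpaceTimeOn (Icc 0 t) (fun (_ : ℝ) (_ : T3) => (0 : ℝ)) :=
    Torus.isSmoothSpaceTimeOn_const (Torus.isSmooth_const (0 : ℝ)) _
  have h0ψ : Torus.IsSmoothSpaceTimeOn (Icc 0 t) (fun (_ : ℝ) (_ : T3) => (0 : V3)) :=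
    Torus.isSmoothSpaceTimeOn_const (Torus.isSmooth_const (0 : V3)) _
  -- the three small events: not dilute, and the two channels at level `δ/2`
  have hlim : Tendsto (fun N : ℕ => localGibbsLaw σ a₀ u₀ θ₀ N (Φ N)
        {z | ∃ s ∈ Icc 0 t, ∃ x : T3, η₁ < rhoB φ N ((Φ N).flow s z) x * σ ^ 3} +
      (localGibbsLaw σ a₀ u₀ θ₀ N (Φ N) {z | ∃ τ ∈ Icc 0 t, δ / 2 <
          |Cc σ Φ ψ (fun (_ : ℝ) (_ : T3) => (0 : ℝ)) N z τ -
            Rhs σ Φ φ ψ (fun (_ : ℝ) (_ : T3) => (0 : ℝ)) N z τ|} +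
        localGibbsLaw σ a₀ u₀ θ₀ N (Φ N) {z | ∃ τ ∈ Icc 0 t, δ / 2 <
          |Cc σ Φ (fun (_ : ℝ) (_ : T3) => (0 : V3)) χ N z τ -
            Rhs σ Φ φ (fun (_ : ℝ) (_ : T3) => (0 : V3)) χ N z τ|})) atTop (𝓝 0) := by
    have h := hDil.add ((hA (δ / 2) (half_pos hδ)).add (hB (δ / 2) (half_pos hδ)))
    rwa [add_zero, add_zero] at h
  refine tendsto_of_tendsto_of_tendsto_of_le_of_le tendsto_const_nhds hlim (fun N => zero_le)
    fun N => ?_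
  -- union bound off the null bad set of the flow
  refine measure_le_of_imp3 _ (localGibbsLaw_compl_good' (Φ N)) fun z hzB hz hzW hzE => ?_
  obtain ⟨τ, hτ, hτδ⟩ := hzB
  simp only [mem_setOf_eq, not_exists, not_and, not_lt] at hzW hzE ⊢
  refine ⟨τ, hτ, ?_⟩
  -- on a good, all-times-dilute datum both `Cc` and `Rhs` split by channel
  have hCc : Cc σ Φ ψ χ N z τ = Cc σ Φ ψ (fun (_ : ℝ) (_ : T3) => (0 : ℝ)) N z τ +
      Cc σ Φ (fun (_ : ℝ) (_ : T3) => (0 : V3)) χ N z τ := by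
    rw [hBal N t ht ψ χ hψ hχ z hz τ hτ, hBal N t ht ψ _ hψ h0χ z hz τ hτ,
      hBal N t ht _ χ h0ψ hχ z hz τ hτ]
    exact Jfun_add Φ ψ χ hz τ
  have hRhs := Rhs_add hσ hK hη₁ hη₁Z hZK Φ (hφc N) (hφ0 N) ht hψ hχ hz hzW hτ
  have hsplit : |Cc σ Φ ψ χ N z τ - Rhs σ Φ φ ψ χ N z τ| ≤
      |Cc σ Φ ψ (fun (_ : ℝ) (_ : T3) => (0 : ℝ)) N z τ -
          Rhs σ Φ φ ψ (fun (_ : ℝ) (_ : T3) => (0 : ℝ)) N z τ| +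
        |Cc σ Φ (fun (_ : ℝ) (_ : T3) => (0 : V3)) χ N z τ -
          Rhs σ Φ φ (fun (_ : ℝ) (_ : T3) => (0 : V3)) χ N z τ| := by
    rw [hCc, hRhs]
    refine (le_of_eq (congrArg _ ?_)).trans (abs_add_le _ _)
    ring
  have hE := hzE τ hτ
  linarith

end

end Summit.AtomisticToContinuum.HydrodynamicLimit.Theorems.HemisphereAffineSlaving
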